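import Mathlib

/-!
# X193 kernel line, file F1: elementary inequalities (layer A0)

Solo seat `solo-Schanuel-informed`, X193 kernel programme (design note
`work/s213/X193-KERNEL-DESIGN.md` in the seat's HOME; pen proof `work/s194/X193-pen.md`).

THEOREM X193 (pen-level, s194; kernel target of this programme, conditional on the
typed fact `Literature.NumberTheory.Transcendental.Roy2010.prop_3_1`, for `β > 2`):
for `ξ` transcendental, `0 < σ < 1` and `ν > 1 + β - σβ/(β+σ)` there is no sequence
`R_n ∈ ℤ[T] \ 0`, `deg R_n ≤ n`, `H(R_n) ≤ exp (n ^ β)`, with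
`|R_n (k ξ)| ≤ exp (-n ^ ν)` for all integers `1 ≤ k ≤ n ^ σ`; node form
`Set.Ioi (1 + β - σ*β/(β+σ)) ⊆ royAdditiveSVEExponents ξ β σ 0`.

This file contains only polynomial-free real inequalities used by the abstract
cross-level count (layer A1 of the design):
* `soloX_min_mul_le`, `soloX_sum_erase_min_eq`, `soloX_two_mul_sub_le_sum_min`:
  the pairing ("sorting") lower bound for liquid columns (pen §6 (F1)):
  for nonnegative weights bounded by `M`, the ordered-pair sum of minima is at least
  `2 (W - M)`;
* `soloX_loc_core`: the localisation algebra (pen §4 (loc));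
* `soloX_fare_lower_of_shallow`: the entry-fare bound in case (a') of pen §5;
* `soloX_exists_rate`: the exponent endgame of pen §7: condition (★) is solvable in
  `a > 0` exactly when `γ (β + σ) > σ ^ 2`, i.e. `ν > 1 + β - σβ/(β+σ)`.
No definitions are introduced.
-/

namespace Summit.Schanuel.Schanuel.Theorems

open Finset

/-- Weighted minimum: for multiplicities `m₁, m₂ ≥ 1` and nonnegative banks `d₁, d₂`,
`min (m₁ d₁) (m₂ d₂) ≤ m₁ m₂ min d₁ d₂`.  Used to pass from the weights
`w_P = m_P d_P` of pen §6 (F1) to the PAIR inequality, which bounds `min d_P d_Q`. -/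
theorem soloX_min_mul_le {m₁ m₂ d₁ d₂ : ℝ} (hm₁ : 1 ≤ m₁) (hm₂ : 1 ≤ m₂)
    (hd₁ : 0 ≤ d₁) (hd₂ : 0 ≤ d₂) :
    min (m₁ * d₁) (m₂ * d₂) ≤ m₁ * m₂ * min d₁ d₂ := by
  rcases le_total d₁ d₂ with h | h
  · rw [min_eq_left h]
    have h0 : 0 ≤ m₁ * d₁ := mul_nonneg (by linarith) hd₁
    calc min (m₁ * d₁) (m₂ * d₂) ≤ m₁ * d₁ := min_le_left _ _
      _ ≤ m₁ * m₂ * d₁ := by nlinarith [mul_nonneg h0 (sub_nonneg.mpr hm₂)]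
  · rw [min_eq_right h]
    have h0 : 0 ≤ m₂ * d₂ := mul_nonneg (by linarith) hd₂
    calc min (m₁ * d₁) (m₂ * d₂) ≤ m₂ * d₂ := min_le_right _ _
      _ ≤ m₁ * m₂ * d₂ := by nlinarith [mul_nonneg h0 (sub_nonneg.mpr hm₁)]

/-- If `i₀` maximises `w` on `s`, the minima of `w i₀` against the other weights sum to
the total weight minus `w i₀`. -/
theorem soloX_sum_erase_min_eq {ι : Type*} [DecidableEq ι] (s : Finset ι) (w : ι → ℝ)
    {i₀ : ι} (hi₀ : i₀ ∈ s) (hmax : ∀ j ∈ s, w j ≤ w i₀) :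
    ∑ j ∈ s.erase i₀, min (w i₀) (w j) = (∑ j ∈ s, w j) - w i₀ := by
  have h1 : ∑ j ∈ s.erase i₀, min (w i₀) (w j) = ∑ j ∈ s.erase i₀, w j := by
    refine Finset.sum_congr rfl fun j hj => ?_
    exact min_eq_right (hmax j (Finset.mem_of_mem_erase hj))
  rw [h1, ← Finset.sum_erase_add s w hi₀]
  ring

/-- Pairing lower bound (pen §6 (F1), "by sorting"): for nonnegative weights `w` on a
nonempty finite set `s`, all bounded by `M`, the sum over ordered pairs of distinct
indices of `min (w i) (w j)` is at least `2 (W - M)`, where `W = ∑ w`.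
(Proof: keep only the pairs through a maximiser `i₀`; each contributes `w j`.) -/
theorem soloX_two_mul_sub_le_sum_min {ι : Type*} [DecidableEq ι] (s : Finset ι)
    (hs : s.Nonempty) (w : ι → ℝ) (hw : ∀ i ∈ s, 0 ≤ w i) {M : ℝ}
    (hM : ∀ i ∈ s, w i ≤ M) :
    2 * ((∑ i ∈ s, w i) - M) ≤ ∑ i ∈ s, ∑ j ∈ s.erase i, min (w i) (w j) := by
  obtain ⟨i₀, hi₀, hmax⟩ := Finset.exists_max_image s w hs
  have key : ∀ i ∈ s.erase i₀,
      min (w i) (w i₀) ≤ ∑ j ∈ s.erase i, min (w i) (w j) := by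
    intro i hi
    have hi' : i ∈ s := Finset.mem_of_mem_erase hi
    have hi₀' : i₀ ∈ s.erase i :=
      Finset.mem_erase.mpr ⟨(Finset.ne_of_mem_erase hi).symm, hi₀⟩
    exact Finset.single_le_sum (f := fun j => min (w i) (w j))
      (fun j hj => le_min (hw i hi') (hw j (Finset.mem_of_mem_erase hj))) hi₀'
  have hA : ∑ j ∈ s.erase i₀, min (w i₀) (w j) = (∑ j ∈ s, w j) - w i₀ :=
    soloX_sum_erase_min_eq s w hi₀ hmax
  have hB : ∑ i ∈ s.erase i₀, min (w i) (w i₀) = (∑ j ∈ s, w j) - w i₀ := by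
    have : ∑ i ∈ s.erase i₀, min (w i) (w i₀) =
        ∑ i ∈ s.erase i₀, min (w i₀) (w i) :=
      Finset.sum_congr rfl fun i _ => min_comm _ _
    rw [this, hA]
  have hMi₀ : w i₀ ≤ M := hM i₀ hi₀
  calc 2 * ((∑ i ∈ s, w i) - M) ≤ 2 * ((∑ i ∈ s, w i) - w i₀) := by linarith
    _ = (∑ j ∈ s.erase i₀, min (w i₀) (w j)) +
          ∑ i ∈ s.erase i₀, min (w i) (w i₀) := by
        rw [hA, hB]; ring
    _ ≤ (∑ j ∈ s.erase i₀, min (w i₀) (w j)) +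
          ∑ i ∈ s.erase i₀, ∑ j ∈ s.erase i, min (w i) (w j) :=
        add_le_add le_rfl (Finset.sum_le_sum key)
    _ = ∑ i ∈ s, ∑ j ∈ s.erase i, min (w i) (w j) := by
        rw [add_comm]
        exact Finset.sum_erase_add s (fun i => ∑ j ∈ s.erase i, min (w i) (w j)) hi₀

/-- Localisation algebra (pen §4 (loc)): if one server of multiplicity `m ≥ 0` supplies
`lam * R ≤ m * d` at a column where its bank is capped, `d ≤ 2 g L + E`, with `g ≥ 1`,
`L, E ≥ 0`, and the degree budget gives `m g ≤ n`, then `lam * R ≤ 2 n L + n E`.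
(With `R = n ^ ν`, `E = B g² log n ≤ B n g log n` this is `L ≥ (λ n^{ν-1} - o(1))/2`.) -/
theorem soloX_loc_core {lam R m d g L E n : ℝ} (hsup : lam * R ≤ m * d)
    (hcap : d ≤ 2 * g * L + E) (hm : 0 ≤ m) (hg : 1 ≤ g) (hL : 0 ≤ L) (hE : 0 ≤ E)
    (hbud : m * g ≤ n) : lam * R ≤ 2 * n * L + n * E := by
  have hmn : m ≤ n := by nlinarith [mul_le_mul_of_nonneg_left hg hm]
  calc lam * R ≤ m * d := hsup
    _ ≤ m * (2 * g * L + E) := mul_le_mul_of_nonneg_left hcap hm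
    _ = 2 * (m * g) * L + m * E := by ring
    _ ≤ 2 * n * L + n * E := by
        nlinarith [mul_le_mul_of_nonneg_right hbud hL, mul_le_mul_of_nonneg_right hmn hE]

/-- Entry fare, case (a') of pen §5: a server `P` with multiplicity `m > 0` at level `n`,
serving `s > 0` assigned columns each with bank `≥ lam * R / m` (`R = Req_n > 0`), whose
banks at those columns are bounded in total by `Ce * t` (the (L1) bound at the entry level,
`t = 1 + ε > 0`), and whose cost is monotone (`Ce ≤ Cn`), has fare
`f = m Cn / (R s) ≥ lam / t`. -/
theorem soloX_fare_lower_of_shallow {lam R m s Ce Cn t : ℝ} (hR : 0 < R) (hm : 0 < m)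
    (hs : 0 < s) (ht : 0 < t) (hL1 : s * (lam * R / m) ≤ Ce * t) (hmono : Ce ≤ Cn) :
    lam / t ≤ m * Cn / (R * s) := by
  have h1 : s * lam * R ≤ Ce * t * m := by
    have := mul_le_mul_of_nonneg_right hL1 hm.le
    calc s * lam * R = s * (lam * R / m) * m := by field_simp
      _ ≤ Ce * t * m := this
  have h2 : Ce * t * m ≤ Cn * t * m := by
    have := mul_le_mul_of_nonneg_right hmono (mul_pos ht hm).le
    nlinarith
  rw [div_le_div_iff₀ ht (mul_pos hR hs)]
  nlinarith

/-- Exponent endgame (pen §7, condition (★)): with `κ' = (σ - γ) / β`, `β > 0` and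
`γ < σ`, if `γ (β + σ) > σ ^ 2` (equivalently `ν = 1 + β - σ + γ > 1 + β - σβ/(β+σ)`)
then there is `a > 0` with `(1 + a) (σ - γ) < σ (1 - κ')`. -/
theorem soloX_exists_rate {β σ γ : ℝ} (hβ : 0 < β) (hγσ : γ < σ)
    (hthr : σ ^ 2 < γ * (β + σ)) :
    ∃ a : ℝ, 0 < a ∧ (1 + a) * (σ - γ) < σ * (1 - (σ - γ) / β) := by
  have hB : 0 < σ - γ := sub_pos.mpr hγσ
  have hBne : σ - γ ≠ 0 := hB.ne'
  have hβne : β ≠ 0 := hβ.ne'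
  have hA : 0 < σ * (1 - (σ - γ) / β) - (σ - γ) := by
    have : σ * (1 - (σ - γ) / β) - (σ - γ) = (γ * (β + σ) - σ ^ 2) / β := by
      field_simp
      ring
    rw [this]
    exact div_pos (by linarith) hβ
  refine ⟨(σ * (1 - (σ - γ) / β) - (σ - γ)) / (2 * (σ - γ)),
    div_pos hA (by linarith), ?_⟩
  have : (1 + (σ * (1 - (σ - γ) / β) - (σ - γ)) / (2 * (σ - γ))) * (σ - γ)
      = (σ - γ) + (σ * (1 - (σ - γ) / β) - (σ - γ)) / 2 := by
    field_simp
  rw [this]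
  linarith

/-- The threshold identity: for `β + σ > 0`, `γ (β + σ) > σ ^ 2` iff
`1 + β - σ + γ > 1 + β - σ * β / (β + σ)` (the pen's `ν > ν*`). -/
theorem soloX_threshold_iff {β σ γ : ℝ} (hβσ : 0 < β + σ) :
    σ ^ 2 < γ * (β + σ) ↔ 1 + β - σ * β / (β + σ) < 1 + β - σ + γ := by
  have hne : β + σ ≠ 0 := hβσ.ne'
  constructor
  · intro h
    have : σ * β / (β + σ) = σ - σ ^ 2 / (β + σ) := by field_simp; ring
    rw [this]
    have h2 : σ ^ 2 / (β + σ) < γ := by rw [div_lt_iff₀ hβσ]; linarith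
    linarith
  · intro h
    have : σ * β / (β + σ) = σ - σ ^ 2 / (β + σ) := by field_simp; ring
    rw [this] at h
    have h2 : σ ^ 2 / (β + σ) < γ := by linarith
    rw [div_lt_iff₀ hβσ] at h2
    linarith

end Summit.Schanuel.Schanuel.Theorems
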